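import Summits.QuantumFields.BalabanUV.Beta.GAN24.BiStencilZeroMode
import Summits.QuantumFields.BalabanUV.Beta.GAN24.ZeroModeSandwich

/-!
# `BalabanUV.Beta.GAN24.LinT2ZeroMode` — binder row G-an2-4 / (CONV-C), W-slot (pre-trigger; idle-seat one-shot kernel lemma
# «T2-ZERO-MODE-KERNEL*», leaf-02 gen 15): **THE ZERO-MODE CHARGE OF THE LINEAR SECOND-ORDER TRANSPORT**
# `linT2 K N T := (μ y ν y′) ↦ mmRead N (K ∘ vertex2OfK K N T μ y ν y′ ∘ K)` IN TERMS OF THE CHARGE OF `T` AND FOUR COARSE LEG SUMS OF `K`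

NOT IN PRINT; OUR BOOKKEEPING (G-an2-4 formalisation swarm, idle leaf seat `b2b-balaban-gan24-formalise-leaf-02`, gen 15 = test (t1)
`zeroMode_linT2_eq` of leaf-18 gen 15's note «T₂ ZERO MODE» ∕ `HOME/b2b-balaban-gan24-formalise-leaf-18/gen15/T2-ZERO-MODE.md` §3∕§7, in
GENERIC form; module name PROVISIONAL — the row owner gan24-p1 ∕ the (P4) author an2 may rename or re-home it).  HONEST FRAMING (cell
contract, verbatim): «discharging `BetaPertH` makes Bałaban's UV stability UNCONDITIONAL — a real constructive-QFT result; it is NOT the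
continuum limit and NOT the Clay problem.»  HONEST DEPENDENCY (verbatim): «continuum YM on T⁴ ⇐ BetaPertH ∧ nine spine estimates (0/9
proved); BetaPertH ⇐ (D1) ∧ (D4) ∧ CAP+tail; G-an2-4 gates asym, D1 and NE2/3/4.»  [folklore] lattice-sum algebra over an2∕an4's DEFINED
objects, all BY NAME (`ExpKernelCalculus.comp`∕`Decays`∕`shiftK`, `OneStepKernelFamily.colH`∕`vertexOfK`∕`abs_colH_le`,
`OneStepResolventKernel.wsum`, `BalabanCompositeJets.LocStencil₂`, `SecondOrderResponse.vertex2OfK`∕`vertex2OfK_translate`,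
`BalabanStepJetsSucc.mmRead`∕`mmRead_shiftK_smul`∕`comp_sandwich_shiftK`); cites nothing, mints no `def … : Prop`, pins no colour constant,
instantiates no wall binder, asserts NO shape of Bałaban's tables; «T2Shape» ∕ «T2SupRate» stay LOCATED ∕ OPEN; discharges NOTHING of
(hW, hWall); NOT «W-slot closed», NEVER «G-an2-4 closed»; NOT `BetaPertH`, NOT continuum, NOT Clay.

## Why (context only; asserted nowhere below)

In an2's recursion `BalabanStepW2.T2Of (j+1) = (cE₂·wV4 (j+1)) • e4OfW j (Spure j) (M1 j) (W2SymOfK K_j Lc … (T2Of j) …) + border`, the previous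
member enters `e4OfW` only through `−mmRead Lc (K_j ∘ W ∘ K_j)` (`K3OfK`) with `W ⊇ ½(vertex2OfK K_j Lc (T2Of j) μ y ν y′ + swap)`: the map
`T ↦ linT2 K N T` below is that `T`-linear building block (sign, `½(1+swap)`, colour weight and the `T`-free pieces of `K3OfK`∕`W2OfK` left to
the consumer).  leaf-18's note located the obstruction to a `j`-induction for «T2Shape» at the coherent colour weight in the ZERO MODE of this
map; this file computes that zero mode exactly, for ANY decaying block-covariant `K` with position-independent coarse leg sums, in any `d`.

## What (generic `d`, blocking `N ≥ 1`; `zmode` = `GAN24/BiStencilZeroMode.zmode`, Fubini = `GAN24/ZeroModeSandwich.nested_integrand_eq`)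

* `linT2 K N T` (definition); `linT2_translate` (coarse joint covariance from `K`'s block covariance and `T`'s joint `N`-covariance).
* `tsum_colH_cell`: for block-covariant `K` with multiplier-COLUMN coarse sums `Σ'_{z′} K z (N•z′) b (inr β) = cR b β` (independent of `z`),
  every cell sum of the first column leg is `Σ'_t colH K N μ 0 κ (N•t + r) = cR (inl κ) μ`.
* **`zmode_one_linT2`**: for `K` with `Decays K C m` (`m > 0`), block covariance, multiplier-ROW coarse sums `Σ'_{x′} K (N•x′) x (inr α) a =
  cL α a` and multiplier-COLUMN coarse sums `cR` as above, and a `LocStencil₂` (`δ > 0`) jointly `N`-covariant `T`: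
  `zmode 1 (linT2 K N T) μ ν (inl α) (inl β) = Σ_{g f κ κ′} (cR (inl κ) μ · cR (inl κ′) ν · cL α f · cR g β) · zmode N T κ κ′ f g`.
* `zmode_one_linT2_kronecker`: Kronecker field-leg charges (`cL α (inl a) = σL·[a=α]`, `cR (inl b) β = σR·[b=β]`) and an ff-valued `T` give
  `σL·σR³ · zmode N T μ ν (inl α) (inl β)` — per COARSE cell `σL σR³` times the charge of `T` per FINE period cell (`N^{d+1}` cells: leaf-18's
  density form `N^{d+1}·σ₀⁴`; for `K = unitK_j (KInvStep Lc j)` an4's `HessianTelescopingKKT.constReproSum_stepCol` gives `σR = δ·Lc^{−(d+2)}`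
  `j`-free — the INSTANCE is not in this file).
* `zmode_one_swap`, `zmode_one_linT2_swap`: the swapped bi-vertex `vertex2OfK K N T ν y′ μ y` (second term of `W2SymOfK`'s `½(1+swap)`) has the
  same charge with `μ ↔ ν` in the two column-leg factors.
-/

noncomputable section

open Finset
open scoped BigOperators
open Literature.MathematicalPhysics.QuantumFieldTheory
open Literature.MathematicalPhysics.QuantumFieldTheory.Balaban1983to89
open Literature.MathematicalPhysics.QuantumFieldTheory.Balaban1983to89.Beta
open B12Sec2to5 (l1)
open ExpKernelCalculus (MKer Decays comp shiftK)
open OneStepResolventKernel (Fib wsum)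
open OneStepKernelFamily (colH abs_colH_le vertexOfK)
open BalabanCompositeJets (LocStencil₂)
open SecondOrderResponse (vertex2OfK vertex2OfK_translate)
open BalabanStepJetsSucc (mmRead mmRead_inl_inl mmRead_shiftK_smul comp_sandwich_shiftK)
open AffineAveraging (toSite)
open Summit.QuantumFields.BalabanUV.Beta.GAN24.BiStencilZeroMode (Tab zmode zmode_one inner_periodic tsum_mul_periodic)
open Summit.QuantumFields.BalabanUV.Beta.GAN24.ZeroModeSandwich (integrand nested_integrand_eq summable_leg_mul_table)

namespace Summit.QuantumFields.BalabanUV.Beta.GAN24.LinT2ZeroMode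


variable {d N : ℕ} [NeZero N]

/-! ## §1 The transported family, the table bound, the cell sums of the first column leg -/

/-- [folklore] **THE LINEAR SECOND-ORDER TRANSPORT** of a bi-stencil family `T` through a packed kernel `K` at blocking `N`:
`linT2 K N T μ y ν y′ := mmRead N (K ∘ vertex2OfK K N T μ y ν y′ ∘ K)` — the `T`-LINEAR building block of an2's
`e4OfW j S M (W2SymOfK K N S M T M₂)` (there: `K = KInvStep Lc j`, `N = Lc`, with a minus sign, the swap-symmetrisation `½(1 + swap)` and the
`T`-independent pieces of `K3OfK`∕`W2OfK` added), read as a bi-stencil family on the coarse lattice.  A definition asserting nothing. -/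
def linT2 (K : MKer (d + 1) (Fib d)) (N : ℕ) (T : Tab d) : Tab d :=
  fun μ y ν y' => mmRead N (comp (comp K (vertex2OfK K N T μ y ν y')) K)

omit [NeZero N] in
/-- [folklore] A `LocStencil₂` bound in the three-factor form of `ZeroModeFubini`. -/
theorem abs_le_of_locStencil₂ {T : Tab d} {CT δ : ℝ} (hT : LocStencil₂ T CT δ) (κ : Fin (d + 1)) (u : Fin (d + 1) → ℤ)
    (κ' : Fin (d + 1)) (u' x z : Fin (d + 1) → ℤ) (f g : Fib d) :
    |T κ u κ' u' x z f g| ≤ CT * (Real.exp (-δ * l1 (u' - u)) * Real.exp (-δ * l1 (x - u)) * Real.exp (-δ * l1 (z - u))) := by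
  have h := hT κ u κ' u' x z f g
  rw [mul_add, Real.exp_add] at h
  exact h.trans (le_of_eq (by ring))

omit [NeZero N] in
/-- [folklore] **THE CELL SUMS OF THE FIRST COLUMN LEG**: for a block-covariant `K` whose `(inl κ, inr μ)` column has the
position-independent coarse sum `c` (`Σ'_{z′} K z (N•z′) (inl κ) (inr μ) = c` for every `z`), every cell sum of the first column leg is
`Σ'_t colH K N μ 0 κ (N•t + r) = c`. -/
theorem tsum_colH_cell {K : MKer (d + 1) (Fib d)} (hKcov : ∀ t, shiftK (-((N : ℤ) • t)) K = K) {μ κ : Fin (d + 1)} {c : ℝ}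
    (hR : ∀ z, HasSum (fun z' : Fin (d + 1) → ℤ => K z ((N : ℤ) • z') (Sum.inl κ) (Sum.inr μ)) c) (r : Fin (d + 1) → ℤ) :
    ∑' t : Fin (d + 1) → ℤ, colH K N μ 0 κ ((N : ℤ) • t + r) = c := by
  have e : ∀ t : Fin (d + 1) → ℤ, colH K N μ 0 κ ((N : ℤ) • t + r) = K r ((N : ℤ) • (-t)) (Sum.inl κ) (Sum.inr μ) := by
    intro t
    have hc := congrFun (congrFun (congrFun (congrFun (hKcov t) ((N : ℤ) • t + r)) ((N : ℤ) • (0 : Fin (d + 1) → ℤ)))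
      (Sum.inl κ)) (Sum.inr μ)
    simp only [shiftK] at hc
    rw [colH, ← hc, smul_zero, zero_add, smul_neg]
    congr 1
    abel
  simp_rw [e]
  rw [show (∑' t : Fin (d + 1) → ℤ, K r ((N : ℤ) • (-t)) (Sum.inl κ) (Sum.inr μ))
      = ∑' t : Fin (d + 1) → ℤ, K r ((N : ℤ) • t) (Sum.inl κ) (Sum.inr μ) from
    (Equiv.neg (Fin (d + 1) → ℤ)).tsum_eq (fun t => K r ((N : ℤ) • t) (Sum.inl κ) (Sum.inr μ))]
  exact (hR r).tsum_eq

/-! ## §2 The main identity -/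

/-- [folklore] **THE ZERO-MODE CHARGE OF THE LINEAR SECOND-ORDER TRANSPORT.**  Let `K` be a packed kernel on `ℤ^{d+1}` with fibre
`Fib d` which DECAYS (`Decays K C m`, `m > 0`), is BLOCK-COVARIANT at blocking `N` (`shiftK (−N•t) K = K`), and whose multiplier-ROW
coarse sums `Σ'_{x′} K (N•x′) x (inr α) a = cL α a` and multiplier-COLUMN coarse sums `Σ'_{z′} K z (N•z′) b (inr β) = cR b β` do not depend
on the fine point; let `T` be a `LocStencil₂` bi-stencil family (`δ > 0`), jointly `N`-covariant.  Then the period-`1` zero-mode charge of the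
transported family is a finite combination of the period-`N` zero-mode charges of `T`:
`zmode 1 (linT2 K N T) μ ν (inl α) (inl β) = Σ_{g f κ κ′} (cR (inl κ) μ · cR (inl κ′) ν · cL α f · cR g β) · zmode N T κ κ′ f g`.
For Kronecker charges of the field legs (`cR (inl κ) μ = σ·δ_{κμ}`, `cL α (inl a) = σ′·δ_{αa}`) and an ff-valued `T` this is
`σ′σ³ · zmode N T μ ν (inl α) (inl β)` (`zmode_one_linT2_kronecker`). -/
theorem zmode_one_linT2 {K : MKer (d + 1) (Fib d)} {C m : ℝ} (hK : Decays K C m) (hm : 0 < m)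
    (hKcov : ∀ t, shiftK (-((N : ℤ) • t)) K = K)
    {cL : Fin (d + 1) → Fib d → ℝ} {cR : Fib d → Fin (d + 1) → ℝ}
    (hL : ∀ x α a, HasSum (fun x' : Fin (d + 1) → ℤ => K ((N : ℤ) • x') x (Sum.inr α) a) (cL α a))
    (hR : ∀ z b β, HasSum (fun z' : Fin (d + 1) → ℤ => K z ((N : ℤ) • z') b (Sum.inr β)) (cR b β))
    {T : Tab d} {CT δ : ℝ} (hT : LocStencil₂ T CT δ) (hδ : 0 < δ)
    (hTcov : ∀ κ u κ' u' t, T κ (u + (N : ℤ) • t) κ' (u' + (N : ℤ) • t) = shiftK (-((N : ℤ) • t)) (T κ u κ' u')) (μ ν α β : Fin (d + 1)) :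
    zmode 1 (linT2 K N T) μ ν (Sum.inl α) (Sum.inl β)
      = ∑ g : Fib d, ∑ f : Fib d, ∑ κ : Fin (d + 1), ∑ κ' : Fin (d + 1),
          (cR (Sum.inl κ) μ * cR (Sum.inl κ') ν * cL α f * cR g β) * zmode N T κ κ' f g := by
  rw [zmode_one]
  -- unfold the transported family to the nested sandwich form
  have push : ∀ y' x' z' : Fin (d + 1) → ℤ, linT2 K N T μ 0 ν y' x' z' (Sum.inl α) (Sum.inl β)
      = ∑' z, ∑ g, ∑' x, ∑ f, ∑ κ, ∑' u, ∑ κ', ∑' u',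
          integrand (fun f x' x => K ((N : ℤ) • x') x (Sum.inr α) f) (fun κ u => colH K N μ 0 κ u) (fun κ' y' u' => colH K N ν y' κ' u')
            (fun f g κ κ' u u' x z => T κ u κ' u' x z f g) (fun g z z' => K z ((N : ℤ) • z') g (Sum.inr β)) y' x' z' z g x f κ u κ' u' := by
    intro y' x' z'
    simp only [linT2, mmRead_inl_inl, comp, vertex2OfK, vertexOfK, wsum, integrand]
    refine tsum_congr fun z => Finset.sum_congr rfl fun g _ => ?_
    rw [← tsum_mul_right]
    refine tsum_congr fun x => ?_
    rw [Finset.sum_mul]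
    refine Finset.sum_congr rfl fun f _ => ?_
    rw [Finset.mul_sum, Finset.sum_mul]
    refine Finset.sum_congr rfl fun κ _ => ?_
    rw [← tsum_mul_left, ← tsum_mul_right]
    refine tsum_congr fun u => ?_
    rw [Finset.mul_sum, Finset.mul_sum, Finset.sum_mul]
    refine Finset.sum_congr rfl fun κ' _ => ?_
    rw [← tsum_mul_left, ← tsum_mul_left, ← tsum_mul_right]
  simp_rw [push]
  rw [nested_integrand_eq (N := N) (u₀ := (N : ℤ) • (0 : Fin (d + 1) → ℤ)) hm hδ
    (fun f x' x => hK _ _ _ _) (fun κ u => abs_colH_le hK μ 0 κ u) (fun κ' y' u' => abs_colH_le hK ν y' κ' u')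
    (fun f g κ κ' u u' x z => abs_le_of_locStencil₂ hT κ u κ' u' x z f g) (fun g z z' => hK _ _ _ _)
    (fun f x => hL x α f) (fun κ' u' => hR u' (Sum.inl κ') ν) (fun g z => hR z g β)]
  refine Finset.sum_congr rfl fun g _ => Finset.sum_congr rfl fun f _ => Finset.sum_congr rfl fun κ _ =>
    Finset.sum_congr rfl fun κ' _ => ?_
  -- the remaining column leg against the periodic inner sum: cell decomposition
  rw [tsum_mul_periodic (N := N) (inner_periodic hTcov κ κ' f g)
    (summable_leg_mul_table (u₀ := (N : ℤ) • (0 : Fin (d + 1) → ℤ)) hm hδ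
      (fun κ u => abs_colH_le hK μ 0 κ u) (fun f g κ κ' u u' x z => abs_le_of_locStencil₂ hT κ u κ' u' x z f g) g f κ κ')]
  simp_rw [tsum_colH_cell hKcov (fun z => hR z (Sum.inl κ) μ)]
  rw [zmode, Finset.sum_mul, Finset.mul_sum]
  exact Finset.sum_congr rfl fun r _ => by ring


/-- [folklore] **THE SAME FOR AN ff-VALUED TABLE, WITH FIELD-LEG CHARGES ONLY**: if `T` has no multiplier legs
(`T … a (inr ρ) = 0 = T … (inr ρ) b`), only the coarse sums of `K` against FIELD legs are needed — the multiplier-ROW sums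
`Σ'_{x′} K (N•x′) x (inr α) (inl a) = cL α a` and the multiplier-COLUMN sums `Σ'_{z′} K z (N•z′) (inl b) (inr β) = cR b β` (for
`K = KInvStep Lc j`: an4∕an2's `constReproSum_stepCol` and its transpose; `GAN24/LinT2ZeroModeStep`) — and
`zmode 1 (linT2 K N T) μ ν (inl α) (inl β) = Σ_{b a κ κ′ : Fin (d+1)} (cR κ μ · cR κ′ ν · cL α a · cR b β) · zmode N T κ κ′ (inl a) (inl b)`. -/
theorem zmode_one_linT2_ff {K : MKer (d + 1) (Fib d)} {C m : ℝ} (hK : Decays K C m) (hm : 0 < m)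
    (hKcov : ∀ t, shiftK (-((N : ℤ) • t)) K = K) {cL cR : Fin (d + 1) → Fin (d + 1) → ℝ}
    (hL : ∀ x α a, HasSum (fun x' : Fin (d + 1) → ℤ => K ((N : ℤ) • x') x (Sum.inr α) (Sum.inl a)) (cL α a))
    (hR : ∀ z b β, HasSum (fun z' : Fin (d + 1) → ℤ => K z ((N : ℤ) • z') (Sum.inl b) (Sum.inr β)) (cR b β))
    {T : Tab d} {CT δ : ℝ} (hT : LocStencil₂ T CT δ) (hδ : 0 < δ)
    (hTcov : ∀ κ u κ' u' t, T κ (u + (N : ℤ) • t) κ' (u' + (N : ℤ) • t) = shiftK (-((N : ℤ) • t)) (T κ u κ' u'))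
    (hTr : ∀ κ u κ' u' x z a ρ, T κ u κ' u' x z a (Sum.inr ρ) = 0) (hTl : ∀ κ u κ' u' x z ρ b, T κ u κ' u' x z (Sum.inr ρ) b = 0)
    (μ ν α β : Fin (d + 1)) :
    zmode 1 (linT2 K N T) μ ν (Sum.inl α) (Sum.inl β)
      = ∑ b : Fin (d + 1), ∑ a : Fin (d + 1), ∑ κ : Fin (d + 1), ∑ κ' : Fin (d + 1),
          (cR κ μ * cR κ' ν * cL α a * cR b β) * zmode N T κ κ' (Sum.inl a) (Sum.inl b) := by
  rw [zmode_one]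
  -- unfold the transported family; the multiplier-leg fibre sums drop out
  have push : ∀ y' x' z' : Fin (d + 1) → ℤ, linT2 K N T μ 0 ν y' x' z' (Sum.inl α) (Sum.inl β)
      = ∑' z, ∑ b : Fin (d + 1), ∑' x, ∑ a : Fin (d + 1), ∑ κ, ∑' u, ∑ κ', ∑' u',
          integrand (fun a x' x => K ((N : ℤ) • x') x (Sum.inr α) (Sum.inl a)) (fun κ u => colH K N μ 0 κ u)
            (fun κ' y' u' => colH K N ν y' κ' u') (fun a b κ κ' u u' x z => T κ u κ' u' x z (Sum.inl a) (Sum.inl b))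
            (fun b z z' => K z ((N : ℤ) • z') (Sum.inl b) (Sum.inr β)) y' x' z' z b x a κ u κ' u' := by
    intro y' x' z'
    simp only [linT2, mmRead_inl_inl, comp, vertex2OfK, vertexOfK, wsum, integrand, Fintype.sum_sum_type, hTr, hTl, mul_zero, tsum_zero,
      Finset.sum_const_zero, zero_mul, add_zero]
    refine tsum_congr fun z => Finset.sum_congr rfl fun b _ => ?_
    rw [← tsum_mul_right]
    refine tsum_congr fun x => ?_
    rw [Finset.sum_mul]
    refine Finset.sum_congr rfl fun a _ => ?_
    rw [Finset.mul_sum, Finset.sum_mul]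
    refine Finset.sum_congr rfl fun κ _ => ?_
    rw [← tsum_mul_left, ← tsum_mul_right]
    refine tsum_congr fun u => ?_
    rw [Finset.mul_sum, Finset.mul_sum, Finset.sum_mul]
    refine Finset.sum_congr rfl fun κ' _ => ?_
    rw [← tsum_mul_left, ← tsum_mul_left, ← tsum_mul_right]
  simp_rw [push]
  rw [nested_integrand_eq (N := N) (u₀ := (N : ℤ) • (0 : Fin (d + 1) → ℤ)) hm hδ
    (fun a x' x => hK _ _ _ _) (fun κ u => abs_colH_le hK μ 0 κ u) (fun κ' y' u' => abs_colH_le hK ν y' κ' u')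
    (fun a b κ κ' u u' x z => abs_le_of_locStencil₂ hT κ u κ' u' x z _ _) (fun b z z' => hK _ _ _ _)
    (fun a x => hL x α a) (fun κ' u' => hR u' κ' ν) (fun b z => hR z b β)]
  refine Finset.sum_congr rfl fun b _ => Finset.sum_congr rfl fun a _ => Finset.sum_congr rfl fun κ _ =>
    Finset.sum_congr rfl fun κ' _ => ?_
  rw [tsum_mul_periodic (N := N) (inner_periodic hTcov κ κ' (Sum.inl a) (Sum.inl b))
    (summable_leg_mul_table (u₀ := (N : ℤ) • (0 : Fin (d + 1) → ℤ)) hm hδ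
      (fun κ u => abs_colH_le hK μ 0 κ u) (fun a b κ κ' u u' x z => abs_le_of_locStencil₂ hT κ u κ' u' x z _ _) b a κ κ')]
  simp_rw [tsum_colH_cell hKcov (fun z => hR z κ μ)]
  rw [zmode, Finset.sum_mul, Finset.mul_sum]
  exact Finset.sum_congr rfl fun r _ => by ring

/-! ## §3 Corollaries: Kronecker charges; the swapped bi-vertex by covariance -/

omit [NeZero N] in
/-- [folklore] The zero-mode charge of a family whose second fibre leg is a multiplier leg vanishes for an ff∕fm-valued table. -/
theorem zmode_inr_right_eq_zero {T : Tab d} (hT : ∀ κ u κ' u' x z a ρ, T κ u κ' u' x z a (Sum.inr ρ) = 0) (κ κ' : Fin (d + 1))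
    (a : Fib d) (ρ : Fin (d + 1)) : zmode N T κ κ' a (Sum.inr ρ) = 0 := by
  simp only [zmode, hT, tsum_zero, Finset.sum_const_zero]

omit [NeZero N] in
/-- [folklore] The zero-mode charge of a family whose first fibre leg is a multiplier leg vanishes for an ff∕mf-valued table. -/
theorem zmode_inr_left_eq_zero {T : Tab d} (hT : ∀ κ u κ' u' x z ρ b, T κ u κ' u' x z (Sum.inr ρ) b = 0) (κ κ' : Fin (d + 1))
    (ρ : Fin (d + 1)) (b : Fib d) : zmode N T κ κ' (Sum.inr ρ) b = 0 := by
  simp only [zmode, hT, tsum_zero, Finset.sum_const_zero]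

/-- [folklore] **KRONECKER CHARGES, ff-VALUED TABLE**: if the multiplier-row ∕ multiplier-column coarse sums of `K` against FIELD legs are
Kronecker (`cL α a = σL·[a = α]`, `cR b β = σR·[b = β]` — for `K = KInvStep Lc j`: an4∕an2's `HessianTelescopingKKT.constReproSum_stepCol`
with `σR = (Lc^{j+1})^{−(d+2)}` and `σL = −σR` by `ResolventComposition.GamΦ_eq_neg_wH`, `GAN24/LinT2ZeroModeStep`) and `T` is ff-valued,
then `zmode 1 (linT2 K N T) μ ν (inl α) (inl β) = σL·σR³ · zmode N T μ ν (inl α) (inl β)` — per COARSE cell the charge of the transported table is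
`σL σR³` times the charge of `T` per FINE period cell (`= N^{d+1}` fine cells: leaf-18's density form `N^{d+1}·σ₀⁴`). -/
theorem zmode_one_linT2_kronecker {K : MKer (d + 1) (Fib d)} {C m : ℝ} (hK : Decays K C m) (hm : 0 < m)
    (hKcov : ∀ t, shiftK (-((N : ℤ) • t)) K = K) {cL cR : Fin (d + 1) → Fin (d + 1) → ℝ} {σL σR : ℝ}
    (hL : ∀ x α a, HasSum (fun x' : Fin (d + 1) → ℤ => K ((N : ℤ) • x') x (Sum.inr α) (Sum.inl a)) (cL α a))
    (hR : ∀ z b β, HasSum (fun z' : Fin (d + 1) → ℤ => K z ((N : ℤ) • z') (Sum.inl b) (Sum.inr β)) (cR b β))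
    (hLk : ∀ α a, cL α a = if a = α then σL else 0) (hRk : ∀ b β, cR b β = if b = β then σR else 0)
    {T : Tab d} {CT δ : ℝ} (hT : LocStencil₂ T CT δ) (hδ : 0 < δ)
    (hTcov : ∀ κ u κ' u' t, T κ (u + (N : ℤ) • t) κ' (u' + (N : ℤ) • t) = shiftK (-((N : ℤ) • t)) (T κ u κ' u'))
    (hTr : ∀ κ u κ' u' x z a ρ, T κ u κ' u' x z a (Sum.inr ρ) = 0) (hTl : ∀ κ u κ' u' x z ρ b, T κ u κ' u' x z (Sum.inr ρ) b = 0)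
    (μ ν α β : Fin (d + 1)) :
    zmode 1 (linT2 K N T) μ ν (Sum.inl α) (Sum.inl β) = σL * σR ^ 3 * zmode N T μ ν (Sum.inl α) (Sum.inl β) := by
  rw [zmode_one_linT2_ff hK hm hKcov hL hR hT hδ hTcov hTr hTl,
    Finset.sum_eq_single β (fun b _ hne => by simp [hRk, hne]) (by simp),
    Finset.sum_eq_single α (fun a _ hne => by simp [hLk, hne]) (by simp),
    Finset.sum_eq_single μ (fun κ _ hne => by simp [hRk, hne]) (by simp),
    Finset.sum_eq_single ν (fun κ' _ hne => by simp [hRk, hne]) (by simp)]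
  simp only [hLk, hRk, if_true]
  ring

/-- [folklore] **KRONECKER FIELD-LEG CHARGES AND VANISHING MULTIPLIER-LEG CHARGES, ANY TABLE**: if the coarse sums of `K` against FIELD
legs are Kronecker (`cL α (inl a) = σL·[a = α]`, `cR (inl b) β = σR·[b = β]`) and those against MULTIPLIER legs VANISH (`cL α (inr ρ) = 0 =
cR (inr ρ) β` — for `K = KInvStep Lc j`: leaf-14's (S2c) `GAN24/MultiplierZeroMass.hasSum_KInvStep_mm_left∕right`), then for EVERY `LocStencil₂`
table `T` (off-diagonal fibre slots allowed — they die on the vanishing multiplier-leg charges):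
`zmode 1 (linT2 K N T) μ ν (inl α) (inl β) = σL·σR³ · zmode N T μ ν (inl α) (inl β)` — the row owner's (R14-6) reading «λ·Z_ff(X) + 0». -/
theorem zmode_one_linT2_kronecker' {K : MKer (d + 1) (Fib d)} {C m : ℝ} (hK : Decays K C m) (hm : 0 < m)
    (hKcov : ∀ t, shiftK (-((N : ℤ) • t)) K = K)
    {cL : Fin (d + 1) → Fib d → ℝ} {cR : Fib d → Fin (d + 1) → ℝ} {σL σR : ℝ}
    (hL : ∀ x α a, HasSum (fun x' : Fin (d + 1) → ℤ => K ((N : ℤ) • x') x (Sum.inr α) a) (cL α a))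
    (hR : ∀ z b β, HasSum (fun z' : Fin (d + 1) → ℤ => K z ((N : ℤ) • z') b (Sum.inr β)) (cR b β))
    (hLk : ∀ α a, cL α (Sum.inl a) = if a = α then σL else 0) (hRk : ∀ b β, cR (Sum.inl b) β = if b = β then σR else 0)
    (hL0 : ∀ α ρ, cL α (Sum.inr ρ) = 0) (hR0 : ∀ ρ β, cR (Sum.inr ρ) β = 0)
    {T : Tab d} {CT δ : ℝ} (hT : LocStencil₂ T CT δ) (hδ : 0 < δ)
    (hTcov : ∀ κ u κ' u' t, T κ (u + (N : ℤ) • t) κ' (u' + (N : ℤ) • t) = shiftK (-((N : ℤ) • t)) (T κ u κ' u')) (μ ν α β : Fin (d + 1)) :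
    zmode 1 (linT2 K N T) μ ν (Sum.inl α) (Sum.inl β) = σL * σR ^ 3 * zmode N T μ ν (Sum.inl α) (Sum.inl β) := by
  rw [zmode_one_linT2 hK hm hKcov hL hR hT hδ hTcov, Fintype.sum_sum_type]
  simp only [hR0, mul_zero, zero_mul, Finset.sum_const_zero, add_zero]
  rw [Finset.sum_eq_single β (fun b _ hne => by simp [hRk, hne]) (by simp), Fintype.sum_sum_type]
  simp only [hL0, mul_zero, zero_mul, Finset.sum_const_zero, add_zero]
  rw [Finset.sum_eq_single α (fun a _ hne => by simp [hLk, hne]) (by simp),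
    Finset.sum_eq_single μ (fun κ _ hne => by simp [hRk, hne]) (by simp),
    Finset.sum_eq_single ν (fun κ' _ hne => by simp [hRk, hne]) (by simp)]
  simp only [hLk, hRk, if_true]
  ring

omit [NeZero N] in
/-- [folklore] **COARSE COVARIANCE OF THE TRANSPORTED FAMILY** (an2's `vertex2OfK_translate` ⨾ `comp_sandwich_shiftK` ⨾ `mmRead_shiftK_smul`):
a block-covariant `K` and a jointly `N`-covariant `T` give a jointly `1`-covariant `linT2 K N T` on the coarse lattice. -/
theorem linT2_translate {K : MKer (d + 1) (Fib d)} (hKcov : ∀ t, shiftK (-((N : ℤ) • t)) K = K) {T : Tab d}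
    (hTcov : ∀ κ u κ' u' t, T κ (u + (N : ℤ) • t) κ' (u' + (N : ℤ) • t) = shiftK (-((N : ℤ) • t)) (T κ u κ' u'))
    (μ : Fin (d + 1)) (y : Fin (d + 1) → ℤ) (ν : Fin (d + 1)) (y' t : Fin (d + 1) → ℤ) :
    linT2 K N T μ (y + t) ν (y' + t) = shiftK (-t) (linT2 K N T μ y ν y') := by
  simp only [linT2]
  rw [vertex2OfK_translate hKcov hTcov, comp_sandwich_shiftK (hKcov t), mmRead_shiftK_smul]

omit [NeZero N] in
/-- [folklore] **SWAP UNDER THE PERIOD-1 CHARGE**: for a jointly `1`-covariant coarse family `F`, the charge of the index-swapped family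
`(μ y ν y′) ↦ F ν y′ μ y` is the charge of `F` with the direction indices swapped (re-index the three lattice sums; no summability). -/
theorem zmode_one_swap (F : Tab d) (hF : ∀ μ y ν y' t, F μ (y + t) ν (y' + t) = shiftK (-t) (F μ y ν y')) (μ ν : Fin (d + 1)) (a b : Fib d) :
    zmode 1 (fun μ y ν y' => F ν y' μ y) μ ν a b = zmode 1 F ν μ a b := by
  rw [zmode_one, zmode_one]
  have e : ∀ y' x' z' : Fin (d + 1) → ℤ, F ν y' μ 0 x' z' a b = F ν 0 μ (-y') (x' + -y') (z' + -y') a b := by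
    intro y' x' z'
    have h := hF ν 0 μ (-y') y'
    rw [zero_add, neg_add_cancel] at h
    rw [h]
    simp only [shiftK]
  simp_rw [e]
  rw [← (Equiv.neg (Fin (d + 1) → ℤ)).tsum_eq (fun y' => ∑' x', ∑' z', F ν 0 μ (-y') (x' + -y') (z' + -y') a b)]
  refine tsum_congr fun y' => ?_
  simp only [Equiv.neg_apply, neg_neg]
  rw [← (Equiv.addRight y').tsum_eq (fun x' => ∑' z', F ν 0 μ y' x' z' a b)]
  refine tsum_congr fun x' => ?_
  simp only [Equiv.coe_addRight]
  exact (Equiv.addRight y').tsum_eq (fun z' => F ν 0 μ y' (x' + y') z' a b)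

/-- [folklore] **THE SWAPPED BI-VERTEX** (the second term of an2's `W2SymOfK`'s `½(1 + swap)`): the period-1 charge of
`(μ y ν y′) ↦ mmRead N (K ∘ vertex2OfK K N T ν y′ μ y ∘ K)` is the main formula with `μ ↔ ν` in the two column-leg charges. -/
theorem zmode_one_linT2_swap {K : MKer (d + 1) (Fib d)} {C m : ℝ} (hK : Decays K C m) (hm : 0 < m)
    (hKcov : ∀ t, shiftK (-((N : ℤ) • t)) K = K)
    {cL : Fin (d + 1) → Fib d → ℝ} {cR : Fib d → Fin (d + 1) → ℝ}
    (hL : ∀ x α a, HasSum (fun x' : Fin (d + 1) → ℤ => K ((N : ℤ) • x') x (Sum.inr α) a) (cL α a))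
    (hR : ∀ z b β, HasSum (fun z' : Fin (d + 1) → ℤ => K z ((N : ℤ) • z') b (Sum.inr β)) (cR b β))
    {T : Tab d} {CT δ : ℝ} (hT : LocStencil₂ T CT δ) (hδ : 0 < δ)
    (hTcov : ∀ κ u κ' u' t, T κ (u + (N : ℤ) • t) κ' (u' + (N : ℤ) • t) = shiftK (-((N : ℤ) • t)) (T κ u κ' u')) (μ ν α β : Fin (d + 1)) :
    zmode 1 (fun μ y ν y' => linT2 K N T ν y' μ y) μ ν (Sum.inl α) (Sum.inl β)
      = ∑ g : Fib d, ∑ f : Fib d, ∑ κ : Fin (d + 1), ∑ κ' : Fin (d + 1),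
          (cR (Sum.inl κ) ν * cR (Sum.inl κ') μ * cL α f * cR g β) * zmode N T κ κ' f g := by
  rw [zmode_one_swap _ (linT2_translate hKcov hTcov), zmode_one_linT2 hK hm hKcov hL hR hT hδ hTcov]

end Summit.QuantumFields.BalabanUV.Beta.GAN24.LinT2ZeroMode
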